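import Mathlib
import HarnessLib
import Summits.QuantumFields.YangMills.Theorems.ComplexCouplingChannelContinuumLegGivenGapAlternatingArraysDefs
import Summits.QuantumFields.YangMills.Theorems.ComplexCouplingChannelContinuumLegGivenGapArrayFunctionalReflection
import Summits.QuantumFields.YangMills.Theorems.ComplexCouplingChannelContinuumLegGivenGapArrayFunctionalGrid

/-!
# The mirror copies of a smeared plaquette field: continuity, periodicity, reflection covariance, locality
# (crux `ContinuumLegGivenGap`, stmt-QuantumFields-15828, line `alternating-curvature-arrays`, helper of
# `stub_arrayFunctional`)

Properties of the observable `arrayObs` of `…ContinuumLegGivenGapAlternatingArraysDefs` (the smeared plaquette field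
of orientation `q` and real test function `f`, transported from its home cell `z₀` to the cell `z` of the alternating
grid by the dihedral transport `cornerMap`, read on the periodic lift of a torus configuration):
* the torus plaquette read at an integer corner `Y ∈ ℤ^d` (`Re tr ρ(U_{proj Y, ab})`,
  `plaquetteObs_neg_configShift_torusLift`) depends on `Y` only mod `S` (`plaquetteObs_torusLift_congr`), is continuous,
  depends on its four links, and transforms under the wall reflection `configReflect μ A` of
  `…ArrayFunctionalReflection` by reflecting the corner, with the shift `-e_μ` when `μ` lies in the plaquette plane
  (`plaquetteObs_torusLift_configReflect`);
* hence `arrayObs` is continuous (`continuous_arrayObs`), `N`-periodic in the cell index (`arrayObs_congr_of_intCast_eq`),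
  depends only on the links of the transported plaquettes of the support of `f` (`dependsOn_arrayObs`), and is
  REFLECTION-COVARIANT: the copy in the cell `b'` read on the reflected configuration is the copy in the reflected
  cell `b`, `b + b' ≡ 2c - 1 (mod N)` (`arrayObs_configReflect`) — the bookkeeping of `…ArrayFunctionalGrid`.
[folklore]
-/

set_option autoImplicit false

noncomputable section

namespace Summit.QuantumFields.YangMills.Theorems.ContinuumLegGivenGap

open scoped SchwartzMap
open MeasureTheory
open Literature.MathematicalPhysics.QuantumFieldTheory Literature.MathematicalPhysics.QuantumLattice
open Literature.Probability.LatticeModels (Torus.proj Torus.proj_apply box)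
open Summit.QuantumFields.YangMills.Theorems.ContinuumLegGivenGap.AlternatingArrays
open Summit.QuantumFields.YangMills.Cruxes.ContinuumLimitOnTrajectory.TwoOrbitSynchronisation (PlaqIdx)

/-! ## Plaquettes of the reflected configuration -/

section Plaquettes

variable {d S N : ℕ} {G : Type*} [Group G] (ρ : G →* Matrix (Fin N) (Fin N) ℂ)

/-- A plaquette containing the reflected axis as FIRST direction: the reflected holonomy is a conjugate of the
inverse holonomy of the plaquette hanging below the reflected corner. [folklore] -/
theorem plaquetteHolonomy_configReflect_fst (μ : Fin d) (A : ZMod S) (U : GaugeConfig d S G) (x : Site d S)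
    {b : Fin d} (hb : b ≠ μ) :
    plaquetteHolonomy (configReflect μ A U) x μ b =
      (U (siteReflect μ A x - Pi.single μ 1, μ))⁻¹ *
        (plaquetteHolonomy U (siteReflect μ A x - Pi.single μ 1) μ b)⁻¹ *
          U (siteReflect μ A x - Pi.single μ 1, μ) := by
  unfold plaquetteHolonomy
  rw [configReflect_apply_same, configReflect_apply_of_ne _ _ _ _ hb, configReflect_apply_same,
    configReflect_apply_of_ne _ _ _ _ hb, siteReflect_shift_same, siteReflect_shift_of_ne _ _ _ hb,
    ← siteReflect_eq_shift]
  have hs : (siteReflect μ A x).shift b - Pi.single μ 1 = (siteReflect μ A x - Pi.single μ 1).shift b := by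
    simp only [Site.shift]; abel
  rw [hs]
  group

/-- A plaquette not containing the reflected axis: the reflected holonomy is the holonomy at the reflected corner.
[folklore] -/
theorem plaquetteHolonomy_configReflect_of_ne (μ : Fin d) (A : ZMod S) (U : GaugeConfig d S G) (x : Site d S)
    {a b : Fin d} (ha : a ≠ μ) (hb : b ≠ μ) :
    plaquetteHolonomy (configReflect μ A U) x a b = plaquetteHolonomy U (siteReflect μ A x) a b := by
  unfold plaquetteHolonomy
  rw [configReflect_apply_of_ne _ _ _ _ ha, configReflect_apply_of_ne _ _ _ _ hb,
    configReflect_apply_of_ne _ _ _ _ ha, configReflect_apply_of_ne _ _ _ _ hb,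
    siteReflect_shift_of_ne _ _ _ ha, siteReflect_shift_of_ne _ _ _ hb]

variable [TopologicalSpace G] [IsTopologicalGroup G] [CompactSpace G]

/-- **Plaquette traces of the reflected configuration**: `Re tr ρ((ΘU)_{x,ab}) = Re tr ρ(U_{x',ab})` with
`x' = θx - e_μ` if `μ ∈ {a, b}` (the reflected plaquette hangs below the reflected corner; `Re tr ρ(g⁻¹) = Re tr ρ(g)`)
and `x' = θx` otherwise. [folklore] -/
theorem re_tr_plaquetteHolonomy_configReflect (hρ : Continuous ρ) (μ : Fin d) (A : ZMod S)
    (U : GaugeConfig d S G) (x : Site d S) {a b : Fin d} (hab : a ≠ b) :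
    (ρ (plaquetteHolonomy (configReflect μ A U) x a b)).trace.re =
      (ρ (plaquetteHolonomy U
        (if μ = a ∨ μ = b then siteReflect μ A x - Pi.single μ 1 else siteReflect μ A x) a b)).trace.re := by
  open Literature.RepresentationTheory.CompactGroups in
  by_cases ha : μ = a
  · subst ha
    rw [if_pos (Or.inl rfl), plaquetteHolonomy_configReflect_fst μ A U x (Ne.symm hab),
      show ∀ g h : G, h⁻¹ * g * h = h⁻¹ * g * h⁻¹⁻¹ from fun g h => by rw [inv_inv],
      CompactGroup.trace_conj_eq, CompactGroup.re_trace_map_inv ρ hρ]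
  by_cases hb : μ = b
  · subst hb
    rw [if_pos (Or.inr rfl), plaquetteHolonomy_swap, CompactGroup.re_trace_map_inv ρ hρ,
      plaquetteHolonomy_configReflect_fst μ A U x hab,
      show ∀ g h : G, h⁻¹ * g * h = h⁻¹ * g * h⁻¹⁻¹ from fun g h => by rw [inv_inv],
      CompactGroup.trace_conj_eq, CompactGroup.re_trace_map_inv ρ hρ, plaquetteHolonomy_swap,
      CompactGroup.re_trace_map_inv ρ hρ]
  · rw [if_neg (by tauto), plaquetteHolonomy_configReflect_of_ne μ A U x (Ne.symm ha) (Ne.symm hb)]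

end Plaquettes

/-! ## The torus plaquette read at an integer corner -/

section Corner

variable {d S N : ℕ} {G : Type*} [Group G] (ρ : G →* Matrix (Fin N) (Fin N) ℂ)

omit [Group G] in
/-- Reduction mod `S` of a reflected integer coordinate. [folklore] -/
theorem proj_update_sub (μ : Fin d) (A : ℤ) (Y : Fin d → ℤ) :
    Torus.proj S (Function.update Y μ (A - Y μ)) = siteReflect μ (A : ZMod S) (Torus.proj S Y) := by
  funext j
  by_cases hj : j = μ
  · subst hj; simp [Torus.proj]
  · simp [Torus.proj, hj, siteReflect_apply_of_ne _ _ _ hj]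

omit [Group G] in
/-- Reduction mod `S` of a coordinate shifted down. [folklore] -/
theorem proj_sub_single (Y : Fin d → ℤ) (i : Fin d) :
    Torus.proj S (Y - Pi.single i 1) = Torus.proj S Y - Pi.single i 1 := by
  funext j
  by_cases hj : j = i
  · subst hj; simp [Torus.proj]
  · simp [Torus.proj, hj]

/-- **The torus plaquette read at the integer corner `Y`** (convention `O at Y = O ∘ configShift (-Y)` of the smeared
fields): `Re tr ρ` of the torus holonomy at `proj Y`. [folklore] -/
theorem plaquetteObs_neg_configShift_torusLift [MeasurableSpace G] (Y : Fin d → ℤ) (a b : Fin d)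
    (U : GaugeConfig d S G) :
    plaquetteObs ρ 0 a b (configShift (-Y) (torusLift S U)) =
      (ρ (plaquetteHolonomy U (Torus.proj S Y) a b)).trace.re := by
  -- adapted from `…CurvatureBoostCovariance.Negative.plaquetteObs_configShift_torusLift`
  simp only [plaquetteObs, plaquetteHolonomyZd, plaquetteHolonomy, configShift_apply, sub_neg_eq_add, zero_add,
    torusLift, torusEdge, Function.comp_apply, Site.shift, add_comm (Pi.single _ _) Y, torusProj_add_single,
    Int.cast_one]

/-- The torus plaquette read at `Y` depends on `Y` only mod `S`. [folklore] -/
theorem plaquetteObs_torusLift_congr [MeasurableSpace G] {Y Y' : Fin d → ℤ} (h : ∀ j, (Y j : ZMod S) = (Y' j : ZMod S))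
    (a b : Fin d) (U : GaugeConfig d S G) :
    plaquetteObs ρ 0 a b (configShift (-Y) (torusLift S U)) = plaquetteObs ρ 0 a b (configShift (-Y') (torusLift S U)) := by
  rw [plaquetteObs_neg_configShift_torusLift, plaquetteObs_neg_configShift_torusLift,
    show Torus.proj S Y = Torus.proj S Y' from funext h]

/-- The torus plaquette read at `Y` depends only on its four links. [folklore] -/
theorem dependsOn_plaquetteObs_torusLift [MeasurableSpace G] (Y : Fin d → ℤ) (a b : Fin d) :
    DependsOn (fun U : GaugeConfig d S G => plaquetteObs ρ 0 a b (configShift (-Y) (torusLift S U)))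
      {torusEdge S (Y, a), torusEdge S (Y + Pi.single a 1, b), torusEdge S (Y + Pi.single b 1, a),
        torusEdge S (Y, b)} := by
  -- adapted from `…HypercubicLimit.Negative.dependsOn_torusPlaquette`
  intro U V h
  simp only [plaquetteObs, plaquetteHolonomyZd, configShift_apply, sub_neg_eq_add, zero_add, torusLift,
    Function.comp_apply, add_comm (Pi.single _ _) Y]
  rw [h _ (by simp), h (torusEdge S (Y + Pi.single a 1, b)) (by simp), h (torusEdge S (Y + Pi.single b 1, a)) (by simp),
    h (torusEdge S (Y, b)) (by simp)]

variable [TopologicalSpace G] [IsTopologicalGroup G]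

/-- The torus plaquette read at `Y` is continuous (product topology). [folklore] -/
theorem continuous_plaquetteObs_torusLift [MeasurableSpace G] (hρ : Continuous ρ) (Y : Fin d → ℤ) (a b : Fin d) :
    Continuous fun U : GaugeConfig d S G => plaquetteObs ρ 0 a b (configShift (-Y) (torusLift S U)) := by
  simp only [plaquetteObs_neg_configShift_torusLift]
  unfold plaquetteHolonomy
  refine Complex.continuous_re.comp (Continuous.matrix_trace (hρ.comp ?_))
  fun_prop

variable [CompactSpace G]

/-- **The torus plaquette read at `Y` on the reflected configuration** is the plaquette read at the reflected corner
`Y[μ ↦ A - Y_μ]`, shifted by `-e_μ` if `μ` lies in the plaquette plane. [folklore] -/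
theorem plaquetteObs_torusLift_configReflect [MeasurableSpace G] (hρ : Continuous ρ) (μ : Fin d) (A : ℤ)
    (Y : Fin d → ℤ) {a b : Fin d} (hab : a ≠ b) (U : GaugeConfig d S G) :
    plaquetteObs ρ 0 a b (configShift (-Y) (torusLift S (configReflect μ (A : ZMod S) U))) =
      plaquetteObs ρ 0 a b (configShift
        (-(Function.update Y μ (A - Y μ) - if μ = a ∨ μ = b then Pi.single μ 1 else 0)) (torusLift S U)) := by
  rw [plaquetteObs_neg_configShift_torusLift, plaquetteObs_neg_configShift_torusLift,
    re_tr_plaquetteHolonomy_configReflect ρ hρ μ _ U _ hab, ← proj_update_sub]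
  congr 3
  split_ifs
  · rw [proj_sub_single]
  · rw [sub_zero]

end Corner

/-! ## The mirror copies -/

section Array

variable {G : Type} [Group G] [TopologicalSpace G] [IsTopologicalGroup G] [CompactSpace G]
  [MeasurableSpace G] [BorelSpace G]

/-- **The mirror copy is continuous** in the torus configuration. [folklore] -/
theorem continuous_arrayObs (r : LatticeRep G) (βv a : ℝ) (L m : ℕ) (v z₀ z : Fin 4 → ℤ) (q : PlaqIdx)
    (f : 𝓢(EuclideanSpace ℝ (Fin 4), ℝ)) : Continuous (arrayObs r βv a L m v z₀ z q f) := by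
  unfold arrayObs
  refine continuous_finsetSum _ fun x _ => continuous_const.mul ?_
  exact (continuous_plaquetteObs_torusLift r.ρ r.continuous _ _ _).sub continuous_const

/-- **Periodicity of the mirror copies**: cell indices congruent mod `N` give the same copy
(`3^m N = 2 (2L+1)`, `N` even). [folklore] -/
theorem arrayObs_congr_of_intCast_eq (r : LatticeRep G) (βv a : ℝ) {L m N : ℕ}
    (hPN : (3 : ℤ) ^ m * N = 2 * ((2 * L + 1 : ℕ) : ℤ)) (hN : Even N) (v z₀ : Fin 4 → ℤ) {z z' : Fin 4 → ℤ}
    (h : ∀ μ, (z μ : ZMod N) = (z' μ : ZMod N)) (q : PlaqIdx) (f : 𝓢(EuclideanSpace ℝ (Fin 4), ℝ)) :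
    arrayObs r βv a L m v z₀ z q f = arrayObs r βv a L m v z₀ z' q f := by
  funext U
  unfold arrayObs
  refine Finset.sum_congr rfl fun x _ => ?_
  rw [plaquetteObs_torusLift_congr r.ρ (cornerMap_intCast_congr hPN hN v z₀ q x h)]

/-- **The mirror copy is a local observable**: it depends only on the links of the transported plaquettes of the
lattice points of the box where `f` does not vanish. [folklore] -/
theorem dependsOn_arrayObs (r : LatticeRep G) (βv a : ℝ) (L m : ℕ) (v z₀ z : Fin 4 → ℤ) (q : PlaqIdx)
    (f : 𝓢(EuclideanSpace ℝ (Fin 4), ℝ)) :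
    DependsOn (arrayObs r βv a L m v z₀ z q f)
      {e : Edge 4 (2 * L + 1) | ∃ x ∈ box 4 L, f (a • siteToE x) ≠ 0 ∧
        e ∈ ({torusEdge (2 * L + 1) (cornerMap m v z₀ z q x, q.1.1),
              torusEdge (2 * L + 1) (cornerMap m v z₀ z q x + Pi.single q.1.1 1, q.1.2),
              torusEdge (2 * L + 1) (cornerMap m v z₀ z q x + Pi.single q.1.2 1, q.1.1),
              torusEdge (2 * L + 1) (cornerMap m v z₀ z q x, q.1.2)} : Set (Edge 4 (2 * L + 1)))} := by
  intro U V h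
  unfold arrayObs
  refine Finset.sum_congr rfl fun x hx => ?_
  by_cases hf : f (a • siteToE x) = 0
  · rw [hf, zero_mul, zero_mul]
  · have hUV := dependsOn_plaquetteObs_torusLift r.ρ (cornerMap m v z₀ z q x) q.1.1 q.1.2
      (fun e he => h e ⟨x, hx, hf, he⟩)
    beta_reduce at hUV
    rw [hUV]

/-- A coordinate of the transported corner depends only on that coordinate of the cell index. [folklore] -/
theorem cornerMap_apply (m : ℕ) (v z₀ z : Fin 4 → ℤ) (q : PlaqIdx) (x : Fin 4 → ℤ) (ν : Fin 4) :
    cornerMap m v z₀ z q x ν =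
      cellMap m (v ν) (z₀ ν) (z ν) (x ν) - if (ν = q.1.1 ∨ ν = q.1.2) ∧ ¬ Even (z ν - z₀ ν) then 1 else 0 := rfl

/-- **Reflection covariance of the mirror copies.** For cells `b, b'` of the grid that are mirror images under the
reflection of the block torus through the block boundary `c` in the axis `μ` (`b_μ + b'_μ ≡ 2c - 1 (mod N)`, equal
other coordinates), the copy in `b'` read on the configuration reflected through the lattice wall
`w = v_μ + 3^m c / 2` (`configReflect μ (2v_μ + 3^m c)`) is the copy in `b` (`3^m N = 2 (2L+1)`, `N` even).
[folklore] -/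
theorem arrayObs_configReflect (r : LatticeRep G) (βv a : ℝ) {L m N : ℕ}
    (hPN : (3 : ℤ) ^ m * N = 2 * ((2 * L + 1 : ℕ) : ℤ)) (hN : Even N) (v z₀ : Fin 4 → ℤ) (q : PlaqIdx)
    (f : 𝓢(EuclideanSpace ℝ (Fin 4), ℝ)) (μ : Fin 4) (c : ℤ) {b b' : Fin 4 → ℤ}
    (hμ : (N : ℤ) ∣ 2 * c - 1 - b μ - b' μ) (hν : ∀ ν, ν ≠ μ → b' ν = b ν) (U : GaugeConfig 4 (2 * L + 1) G) :
    arrayObs r βv a L m v z₀ b' q f (configReflect μ ((2 * v μ + 3 ^ m * c : ℤ) : ZMod (2 * L + 1)) U) =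
      arrayObs r βv a L m v z₀ b q f U := by
  unfold arrayObs
  refine Finset.sum_congr rfl fun x _ => ?_
  rw [plaquetteObs_torusLift_configReflect r.ρ r.continuous μ _ _ (ne_of_lt q.2)]
  congr 2
  refine plaquetteObs_torusLift_congr r.ρ (fun ν => ?_) _ _ _
  by_cases hνμ : ν = μ
  · subst hνμ
    rw [Pi.sub_apply, Function.update_self, cornerMap_apply, cornerMap_apply]
    have key := cellMap_reflect hPN hN (v ν) (z₀ ν) (x ν) c hμ (ν = q.1.1 ∨ ν = q.1.2)
    convert key using 3
    split_ifs with hip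
    · simp [Pi.single_eq_same]
    · simp
  · have h0 : (if (μ = q.1.1 ∨ μ = q.1.2) then (Pi.single μ 1 : Fin 4 → ℤ) else 0) ν = 0 := by
      split_ifs
      · rw [Pi.single_eq_of_ne hνμ]
      · rfl
    rw [Pi.sub_apply, Function.update_of_ne hνμ, cornerMap_apply, cornerMap_apply, hν ν hνμ, h0, sub_zero]

/-- **Core support keeps the transported plaquettes strictly inside the positive half-slab.** If `f` is supported in
the core of the home cell `z₀` (spacing `a > 0`), the cell `b` has `b_μ = B` with `B - c ≡ w (mod N)`, `2w + 2 ≤ N`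
(i.e. `b` lies in the positive half of the block torus for the block boundary `c` in the axis `μ`), then every link on
which the copy in `b` depends has its `μ`-coordinate lifted strictly between the lattice wall `A/2`,
`A = 2v_μ + 3^m c`, and its antipode `(A + 2L + 1)/2`, both endpoints for links along `μ`. [folklore] -/
theorem exists_lift_of_mem_arrayObs_support {L m N : ℕ} (hPN : (3 : ℤ) ^ m * N = 2 * ((2 * L + 1 : ℕ) : ℤ))
    {a : ℝ} (ha : 0 < a) (v z₀ : Fin 4 → ℤ) (q : PlaqIdx) {f : 𝓢(EuclideanSpace ℝ (Fin 4), ℝ)}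
    (hf : tsupport f ⊆ physCore a m v z₀) (μ : Fin 4) {b : Fin 4 → ℤ} {B c w : ℕ} (hB : b μ = B)
    (hw : 2 * w + 2 ≤ N) (hbcw : (N : ℤ) ∣ (B : ℤ) - c - w) {e : Edge 4 (2 * L + 1)}
    (he : e ∈ {e : Edge 4 (2 * L + 1) | ∃ x ∈ box 4 L, f (a • siteToE x) ≠ 0 ∧
        e ∈ ({torusEdge (2 * L + 1) (cornerMap m v z₀ b q x, q.1.1),
              torusEdge (2 * L + 1) (cornerMap m v z₀ b q x + Pi.single q.1.1 1, q.1.2),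
              torusEdge (2 * L + 1) (cornerMap m v z₀ b q x + Pi.single q.1.2 1, q.1.1),
              torusEdge (2 * L + 1) (cornerMap m v z₀ b q x, q.1.2)} : Set (Edge 4 (2 * L + 1)))}) :
    ∃ Y : ℤ, e.1 μ = (Y : ZMod (2 * L + 1)) ∧ 2 * v μ + 3 ^ m * c + 1 ≤ 2 * Y ∧
      2 * Y + (if e.2 = μ then 3 else 1) ≤ 2 * v μ + 3 ^ m * c + (2 * L + 1 : ℕ) := by
  obtain ⟨x, -, hfx, he⟩ := he
  have hcore : a • siteToE x ∈ physCore a m v z₀ := hf (subset_tsupport f hfx)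
  obtain ⟨h₁, h₂⟩ := two_mul_bounds_of_mem_physCore ha hcore μ
  obtain ⟨hc₁, hc₂⟩ := two_mul_cornerMap_bounds m v z₀ b q x μ h₁ h₂
  rw [hB] at hc₁ hc₂
  obtain ⟨Y₁, hY₁, hl, hu⟩ := exists_slab_lift hPN hw hbcw (v μ) hc₁ hc₂
  have hq : q.1.1 ≠ q.1.2 := ne_of_lt q.2
  -- the lift of the `μ`-coordinate of a corner shifted by `e_i`
  have key : ∀ (i j : Fin 4), i ≠ j →
      ∃ Y : ℤ, (torusEdge (2 * L + 1) (cornerMap m v z₀ b q x + Pi.single i 1, j)).1 μ = (Y : ZMod (2 * L + 1)) ∧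
        2 * v μ + 3 ^ m * c + 1 ≤ 2 * Y ∧
        2 * Y + (if (torusEdge (2 * L + 1) (cornerMap m v z₀ b q x + Pi.single i 1, j)).2 = μ then 3 else 1) ≤
          2 * v μ + 3 ^ m * c + (2 * L + 1 : ℕ) := by
    intro i j hij
    refine ⟨Y₁ + (Pi.single i 1 : Fin 4 → ℤ) μ, ?_, ?_, ?_⟩
    · show ((((cornerMap m v z₀ b q x + Pi.single i 1 : Fin 4 → ℤ) μ : ℤ)) : ZMod (2 * L + 1)) = _
      rw [Pi.add_apply]; push_cast; rw [hY₁]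
    · have : 0 ≤ (Pi.single i 1 : Fin 4 → ℤ) μ := by by_cases h : μ = i <;> simp [h]
      omega
    · show 2 * (Y₁ + (Pi.single i 1 : Fin 4 → ℤ) μ) + (if j = μ then 3 else 1) ≤ _
      by_cases hμi : μ = i
      · subst hμi; rw [Pi.single_eq_same, if_neg (Ne.symm hij)]; omega
      · rw [Pi.single_eq_of_ne hμi]; split_ifs <;> omega
  have key0 : ∀ j : Fin 4,
      ∃ Y : ℤ, (torusEdge (2 * L + 1) (cornerMap m v z₀ b q x, j)).1 μ = (Y : ZMod (2 * L + 1)) ∧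
        2 * v μ + 3 ^ m * c + 1 ≤ 2 * Y ∧
        2 * Y + (if (torusEdge (2 * L + 1) (cornerMap m v z₀ b q x, j)).2 = μ then 3 else 1) ≤
          2 * v μ + 3 ^ m * c + (2 * L + 1 : ℕ) := fun j =>
    ⟨Y₁, hY₁.symm, by omega, by show 2 * Y₁ + (if j = μ then 3 else 1) ≤ _; split_ifs <;> omega⟩
  simp only [Set.mem_insert_iff, Set.mem_singleton_iff] at he
  rcases he with rfl | rfl | rfl | rfl
  exacts [key0 _, key _ _ hq, key _ _ hq.symm, key0 _]

end Array

/-- Anchor of this helper file (registered sub-goal of stmt-QuantumFields-15828, helper of `stub_arrayFunctional`):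
the mirror copies are continuous observables of the torus configuration. [folklore] -/
theorem arrayFunctional_anchor_obs :
    ∀ {G : Type} [Group G] [TopologicalSpace G] [IsTopologicalGroup G] [CompactSpace G] [MeasurableSpace G]
      [BorelSpace G] (r : LatticeRep G) (βv a : ℝ) (L m : ℕ) (v z₀ z : Fin 4 → ℤ) (q : PlaqIdx)
      (f : 𝓢(EuclideanSpace ℝ (Fin 4), ℝ)), Continuous (arrayObs r βv a L m v z₀ z q f) :=
  fun r βv a L m v z₀ z q f => continuous_arrayObs r βv a L m v z₀ z q f

end Summit.QuantumFields.YangMills.Theorems.ContinuumLegGivenGap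

end
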